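import Summits.KontsevichZagierPeriods.KontsevichZagierPeriods.Theorems.SymplecticScissorsVolumeFormOffPlaneTwoPeriods
import Summits.KontsevichZagierPeriods.KontsevichZagierPeriods.Theorems.SymplecticScissorsVolumeFormOffPlaneSimplexCell
import Summits.KontsevichZagierPeriods.KontsevichZagierPeriods.Theorems.SymplecticScissorsVolumeFormOffPlaneSubgraphToBase
import Summits.KontsevichZagierPeriods.KontsevichZagierPeriods.Theorems.SymplecticScissorsVolumeFormOffPlanePolynomialBoxCell
import Summits.KontsevichZagierPeriods.KontsevichZagierPeriods.Theorems.HyperbolicBlochOffTetraSectorKernelStubAffineOrbit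
import Summits.KontsevichZagierPeriods.KontsevichZagierPeriods.Theorems.HyperbolicBlochOffTetraSectorKernelStubBakerEnvelopeAux
import Literature.ModelTheory.ExponentialFields.SemialgebraicInterior
import Literature.NumberTheory.Transcendental.KZDirichletPeeling
import Literature.NumberTheory.Transcendental.EllIterRep

/-!
# `VolumeFormOffPlane` (stmt-KontsevichZagierPeriods-14935) — line `Sketch`, v7:
POINT CELLS (the feeders of the two-periods layer)

A K-CELL is an integrand-`1` representation `ρ` with a certificate `[ρ] − [pt, v] ∈ KZ.relations`,
`v` real algebraic (`[pt, v] = KZ.IntegralRep.unit.constMul v hv`). This file produces the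
certificates consumed by `pointCellPairs` / `pointCellOrbitPairs` / `pointCellBallPairs`
(file `…TwoPeriods.lean`, imported), from the landed v7 stubs `stub_simplexCell` (p139010),
`stub_subgraphToBase` (p138794), `stub_polynomialBoxCell` (p139310):

* `affineImagePointCell` — a real-algebraic affine image `A B + b` of a body `B` whose own
  integrand-`1` representation is a K-cell is a K-cell (rule (2) and the scaling endomorphism);
* `ratBoxPointCell`, `algebraicBoxPointCell` — open boxes with rational / real-algebraic corners;
* `simplexPointCell` — open simplices `A Δ_d + b` with real-algebraic data (Dirichlet peeling);
* `prodPointCell` — products of K-cells (cylinders over curved cells, …);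
* `polytopeBallPairs` — the headline instance: algebraic simplices ⊕ algebraic ellipsoids, `d ≥ 2`;
* `subgraphPointCell` — CURVED CELLS: the solid `{x ∈ box, 0 ≤ t ≤ p(x)}` under the graph of a
  rational polynomial `p ≥ 0` over an open rational box (one Newton–Leibniz move, then the cube
  polynomial kernel) — e.g. `{0 < x, y < 1, 0 ≤ z ≤ x² + y²}` (volume `2/3`) is KZ-equivalent to
  every algebraic box of volume `2/3`, and mixes with balls in `pointCellBallPairs`.

Sources: Kontsevich–Zagier 2001, §1.2; folklore.
-/

noncomputable section

open MeasureTheory Set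
open Literature.NumberTheory.Transcendental
open Literature.ModelTheory.ExponentialFields (IsSemialgebraic)

namespace Summit.KontsevichZagierPeriods.SymplecticScissors.LogPolytope

/-! ## Affine images of K-cells -/

/-- **Scaling a point certificate**: `[pt, v]` scaled by a real algebraic `c` is `[pt, c v]`
(same domain, same integrand). [Kontsevich–Zagier 2001, §1.2 rule (1)] [folklore] -/
theorem pc_unit_constMul_constMul {v c : ℝ} (hv : IsAlgebraic ℚ v) (hc : IsAlgebraic ℚ c) :
    KZ.of ((KZ.IntegralRep.unit.constMul v hv).constMul c hc) -
      KZ.of (KZ.IntegralRep.unit.constMul (c * v) (hc.mul hv)) ∈ KZ.relations :=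
  KZ.of_sub_of_mem_relations_of_eqOn rfl fun x _ => by
    simp only [KZ.IntegralRep.integrand_constMul, KZ.IntegralRep.unit_integrand]
    ring

/-- **AFFINE IMAGES OF K-CELLS ARE K-CELLS.** Let `B` be a `ℚ`-semialgebraic body of finite volume
such that the integrand-`1` representations on `B` are K-cells. Then every integrand-`1`
representation on a real-algebraic affine image `A B + b` (`det A ≠ 0`) is a K-cell: one rule-(2)
move to `[B, |det A|]` (`aff_orbit_of_sub_of_mem_changeOfVariablesRel`), and the scaling
endomorphism `KZ.scale |det A|` carries `[B, 1] − [pt, v] ∈ relations` to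
`[B, |det A|] − [pt, |det A| v] ∈ relations`. [Kontsevich–Zagier 2001, §1.2 rules (1), (2)]
[folklore] -/
theorem affineImagePointCell {d : ℕ} {B : Set (Fin d → ℝ)} (hB : IsSemialgebraic ℚ B)
    (hBvol : volume B ≠ ⊤)
    (hK : ∀ O : KZ.IntegralRep d, O.domain = B → (∀ x ∈ O.domain, O.integrand x = 1) →
      ∃ (v : ℝ) (hv : IsAlgebraic ℚ v),
        KZ.of O - KZ.of (KZ.IntegralRep.unit.constMul v hv) ∈ KZ.relations)
    {A : Matrix (Fin d) (Fin d) ℝ} {b : Fin d → ℝ} (hA : ∀ j l, IsAlgebraic ℚ (A j l))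
    (hb : ∀ j, IsAlgebraic ℚ (b j)) (hdet : A.det ≠ 0) (ρ : KZ.IntegralRep d)
    (hdom : ρ.domain = (fun x => A.mulVec x + b) '' B) (hone : ∀ x ∈ ρ.domain, ρ.integrand x = 1) :
    ∃ (v : ℝ) (hv : IsAlgebraic ℚ v),
      KZ.of ρ - KZ.of (KZ.IntegralRep.unit.constMul v hv) ∈ KZ.relations := by
  obtain ⟨O, hOd, hOi⟩ := KZ.exists_oneRep hB hBvol
  obtain ⟨v, hv, hcert⟩ := hK O hOd (fun x _ => by rw [hOi])
  subst hOd
  have halg : IsAlgebraic ℚ |A.det| :=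
    Summit.KontsevichZagierPeriods.HyperbolicBloch.OffTetraSectorKernel.aff_orbit_isAlgebraic_abs_det hA
  -- rule (2): `[O scaled by |det A|] − [ρ]`
  have hmove : KZ.of (O.constMul |A.det| halg) - KZ.of ρ ∈ KZ.relations := by
    refine KZ.changeOfVariablesRel_subset_relations
      (Summit.KontsevichZagierPeriods.HyperbolicBloch.OffTetraSectorKernel.aff_orbit_of_sub_of_mem_changeOfVariablesRel
        A b hA hb hdet (O.constMul |A.det| halg) ρ hdom fun x hx => ?_)
    have hx' : A.mulVec x + b ∈ ρ.domain := by
      rw [hdom]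
      exact mem_image_of_mem _ hx
    simp only [hone _ hx', KZ.IntegralRep.integrand_constMul, hOi]
    ring
  -- the scaling endomorphism on the certificate of `O`
  have hscale : KZ.of (O.constMul |A.det| halg) -
      KZ.of ((KZ.IntegralRep.unit.constMul v hv).constMul |A.det| halg) ∈ KZ.relations := by
    have h := KZ.scale_mem_relations |A.det| halg hcert
    simpa only [map_sub, KZ.scale_of] using h
  refine ⟨|A.det| * v, halg.mul hv, ?_⟩
  have : KZ.of ρ - KZ.of (KZ.IntegralRep.unit.constMul (|A.det| * v) (halg.mul hv)) =
      (KZ.of (O.constMul |A.det| halg) -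
          KZ.of ((KZ.IntegralRep.unit.constMul v hv).constMul |A.det| halg)) +
        (KZ.of ((KZ.IntegralRep.unit.constMul v hv).constMul |A.det| halg) -
          KZ.of (KZ.IntegralRep.unit.constMul (|A.det| * v) (halg.mul hv))) -
        (KZ.of (O.constMul |A.det| halg) - KZ.of ρ) := by
    abel
  rw [this]
  exact KZ.relations.sub_mem (KZ.relations.add_mem hscale (pc_unit_constMul_constMul hv halg))
    hmove

/-! ## Boxes -/

/-- **Rational boxes are K-cells**: the integrand-`1` representation on an open box with rational
corners (`stub_polynomialBoxCell` with the polynomial `1`). [folklore] -/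
theorem ratBoxPointCell (d : ℕ) (a b : Fin d → ℚ) (hab : ∀ i, a i < b i) (ρ : KZ.IntegralRep d)
    (hdom : ρ.domain = {x : Fin d → ℝ | ∀ i, (a i : ℝ) < x i ∧ x i < (b i : ℝ)})
    (hone : ∀ x ∈ ρ.domain, ρ.integrand x = 1) :
    ∃ (v : ℝ) (hv : IsAlgebraic ℚ v),
      KZ.of ρ - KZ.of (KZ.IntegralRep.unit.constMul v hv) ∈ KZ.relations :=
  stub_polynomialBoxCell d a b 1 ρ hab hdom fun x hx => by rw [hone x hx, map_one]

/-- The open unit cube has finite volume (it sits in `[0,1]ᵈ`). [folklore] -/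
theorem pc_volume_unitCube_ne_top (d : ℕ) :
    volume {x : Fin d → ℝ | ∀ i, ((0 : ℚ) : ℝ) < x i ∧ x i < ((1 : ℚ) : ℝ)} ≠ ⊤ := by
  refine ((measure_mono fun x hx => ?_).trans_lt
    (isCompact_Icc (a := (0 : Fin d → ℝ)) (b := 1)).measure_lt_top).ne
  simp only [mem_setOf_eq, Rat.cast_zero, Rat.cast_one] at hx
  exact ⟨fun i => (hx i).1.le, fun i => (hx i).2.le⟩

/-- The open unit cube is `ℚ`-semialgebraic (written with rational-cast corners). [folklore] -/
theorem pc_isSemialgebraic_unitCube (d : ℕ) :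
    IsSemialgebraic ℚ {x : Fin d → ℝ | ∀ i, ((0 : ℚ) : ℝ) < x i ∧ x i < ((1 : ℚ) : ℝ)} := by
  convert KZ.isSemialgebraic_box d using 1
  ext x
  simp [mem_Ioo]

/-- **Algebraic boxes are K-cells**: the integrand-`1` representation on an open box
`{aᵢ < xᵢ < bᵢ}` with REAL ALGEBRAIC corners `a < b` is a K-cell — the affine image
`diag(b − a)·(0,1)ᵈ + a` of the unit cube (`affineImagePointCell`, `ratBoxPointCell`). [folklore] -/
theorem algebraicBoxPointCell (d : ℕ) (a b : Fin d → ℝ) (ha : ∀ i, IsAlgebraic ℚ (a i))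
    (hb : ∀ i, IsAlgebraic ℚ (b i)) (hab : ∀ i, a i < b i) (ρ : KZ.IntegralRep d)
    (hdom : ρ.domain = {x : Fin d → ℝ | ∀ i, a i < x i ∧ x i < b i})
    (hone : ∀ x ∈ ρ.domain, ρ.integrand x = 1) :
    ∃ (v : ℝ) (hv : IsAlgebraic ℚ v),
      KZ.of ρ - KZ.of (KZ.IntegralRep.unit.constMul v hv) ∈ KZ.relations := by
  set A : Matrix (Fin d) (Fin d) ℝ := Matrix.diagonal fun i => b i - a i with hAdef
  have hA : ∀ j l, IsAlgebraic ℚ (A j l) := fun j l => by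
    rw [hAdef, Matrix.diagonal_apply]
    split_ifs
    · exact (hb j).sub (ha j)
    · exact isAlgebraic_zero
  have hdet : A.det ≠ 0 := by
    rw [hAdef, Matrix.det_diagonal]
    exact Finset.prod_ne_zero_iff.2 fun i _ => (sub_pos.2 (hab i)).ne'
  have hchart : ∀ y : Fin d → ℝ, A.mulVec y + a = fun i => a i + (b i - a i) * y i := fun y => by
    funext i
    simp only [hAdef, Pi.add_apply, Matrix.mulVec_diagonal]
    ring
  refine affineImagePointCell (pc_isSemialgebraic_unitCube d) (pc_volume_unitCube_ne_top d)
    (fun O hOd hOi => ratBoxPointCell d 0 1 (fun _ => zero_lt_one) O hOd hOi) hA ha hdet ρ ?_ hone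
  rw [hdom]
  ext x
  simp only [mem_setOf_eq, mem_image, Rat.cast_zero, Rat.cast_one]
  constructor
  · intro hx
    refine ⟨fun i => (x i - a i) / (b i - a i), fun i => ⟨div_pos (sub_pos.2 (hx i).1)
      (sub_pos.2 (hab i)), ?_⟩, ?_⟩
    · rw [div_lt_one (sub_pos.2 (hab i))]
      linarith [(hx i).2]
    · rw [hchart]
      funext i
      have hwi : b i - a i ≠ 0 := (sub_pos.2 (hab i)).ne'
      field_simp
      ring
  · rintro ⟨y, hy, rfl⟩ i
    have hyi := hy i
    rw [hchart]
    have hw0 : 0 < b i - a i := sub_pos.2 (hab i)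
    have h2 : (b i - a i) * y i < b i - a i := by simpa using mul_lt_mul_of_pos_left hyi.2 hw0
    have h1 := mul_pos hw0 hyi.1
    constructor
    · show a i < a i + (b i - a i) * y i
      linarith
    · show a i + (b i - a i) * y i < b i
      linarith

/-! ## Simplices -/

/-- **ALGEBRAIC SIMPLICES ARE K-CELLS**: the integrand-`1` representation on an open simplex
with real algebraic vertices — an affine image `A Δ_d + b` of the open corner simplex
`Δ_d = {x > 0, ∑ xᵢ < 1}` with `A`, `b` real algebraic, `det A ≠ 0` — is a K-cell
(`affineImagePointCell` over `stub_simplexCell`: `[Δ_d, 1] ≡ [pt, 1/d!]`), so algebraic polytopes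
(modulo a written-down triangulation) are a.e. signed combinations of K-cells and MIX with every
other K-cell and, for `d ≥ 2`, with balls. [folklore] -/
theorem simplexPointCell (d : ℕ) (A : Matrix (Fin d) (Fin d) ℝ) (b : Fin d → ℝ)
    (hA : ∀ j l, IsAlgebraic ℚ (A j l)) (hb : ∀ j, IsAlgebraic ℚ (b j)) (hdet : A.det ≠ 0)
    (ρ : KZ.IntegralRep d)
    (hdom : ρ.domain = (fun x => A.mulVec x + b) '' {x : Fin d → ℝ | (∀ i, 0 < x i) ∧ ∑ i, x i < 1})
    (hone : ∀ x ∈ ρ.domain, ρ.integrand x = 1) :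
    ∃ (v : ℝ) (hv : IsAlgebraic ℚ v),
      KZ.of ρ - KZ.of (KZ.IntegralRep.unit.constMul v hv) ∈ KZ.relations :=
  affineImagePointCell (KZ.isSemialgebraic_dirichletSimplex d)
    (Summit.KontsevichZagierPeriods.HyperbolicBloch.OffTetraSectorKernel.env_volume_cornerSimplex_ne_top d)
    (fun O hOd hOi => ⟨_, (isAlgebraic_nat (Nat.factorial d)).inv, stub_simplexCell d O hOd hOi _⟩)
    hA hb hdet ρ hdom hone

/-! ## Curved cells: polynomial subgraphs over rational boxes -/

/-- An open box with rational corners is `ℚ`-semialgebraic. [folklore] -/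
theorem pc_isSemialgebraic_ratBox (d : ℕ) (a b : Fin d → ℚ) :
    IsSemialgebraic ℚ {x : Fin d → ℝ | ∀ i, (a i : ℝ) < x i ∧ x i < (b i : ℝ)} := by
  have h := IsSemialgebraic.biInter (Finset.univ : Finset (Fin d))
    (fun i => {x : Fin d → ℝ | (a i : ℝ) < x i} ∩ {x : Fin d → ℝ | x i < (b i : ℝ)}) fun i _ =>
      (KZ.isSemialgebraic_setOf_const_lt_apply (isAlgebraic_algebraMap (a i)) i).inter
        (KZ.isSemialgebraic_setOf_apply_lt_const (isAlgebraic_algebraMap (b i)) i)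
  convert h using 1
  ext x
  simp

/-- The base representation `[box, p]` of a rational polynomial over an open rational box exists
(polynomial integrand, continuous on the compact closed box). [folklore] -/
theorem pc_exists_polyBoxRep (d : ℕ) (a b : Fin d → ℚ) (p : MvPolynomial (Fin d) ℚ) :
    ∃ r' : KZ.IntegralRep d, r'.domain = {x : Fin d → ℝ | ∀ i, (a i : ℝ) < x i ∧ x i < (b i : ℝ)} ∧
      r'.integrand = fun x => MvPolynomial.aeval x p := by
  refine ⟨⟨_, _, pc_isSemialgebraic_ratBox d a b,
    isSemialgebraicFunOn_aeval (pc_isSemialgebraic_ratBox d a b) p, ?_⟩, rfl, rfl⟩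
  have hcont : Continuous fun x : Fin d → ℝ => (MvPolynomial.aeval x p : ℝ) :=
    Literature.ModelTheory.ExponentialFields.continuous_aeval_real p
  refine (hcont.continuousOn.integrableOn_compact
    (isCompact_Icc (a := fun i => (a i : ℝ)) (b := fun i => (b i : ℝ)))).mono_set fun x hx => ?_
  exact ⟨fun i => (hx i).1.le, fun i => (hx i).2.le⟩

/-- **POLYNOMIAL SUBGRAPHS ARE K-CELLS (curved cells).** For a rational polynomial `p`, non-negative
on the open rational box `{aᵢ < xᵢ < bᵢ}` (`a < b`), the integrand-`1` representation on the solid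
under its graph, `{(x, t) | a < x < b, 0 ≤ t ≤ p(x)}`, is a K-cell: ONE Newton–Leibniz move to
the base `[box, p]` (`stub_subgraphToBase`) and the cube polynomial kernel (`stub_polynomialBoxCell`).
Its volume `∫_box p ∈ ℚ`, and it is KZ-equivalent to every K-cell combination of that volume
(`pointCellPairs`), and mixes with balls (`pointCellBallPairs`). [Kontsevich–Zagier 2001, §1.2]
[folklore] -/
theorem subgraphPointCell (d : ℕ) (a b : Fin d → ℚ) (hab : ∀ i, a i < b i)
    (p : MvPolynomial (Fin d) ℚ)
    (hp : ∀ x : Fin d → ℝ, (∀ i, (a i : ℝ) < x i ∧ x i < (b i : ℝ)) → 0 ≤ MvPolynomial.aeval x p)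
    (ρ : KZ.IntegralRep (d + 1))
    (hdom : ρ.domain = {z : Fin (d + 1) → ℝ |
      (∀ i : Fin d, (a i : ℝ) < z (Fin.castSucc i) ∧ z (Fin.castSucc i) < (b i : ℝ)) ∧
      0 ≤ z (Fin.last d) ∧ z (Fin.last d) ≤ MvPolynomial.aeval (Fin.init z) p})
    (hone : ∀ z ∈ ρ.domain, ρ.integrand z = 1) :
    ∃ (v : ℝ) (hv : IsAlgebraic ℚ v),
      KZ.of ρ - KZ.of (KZ.IntegralRep.unit.constMul v hv) ∈ KZ.relations := by
  obtain ⟨r', hr'd, hr'i⟩ := pc_exists_polyBoxRep d a b p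
  have h1 : KZ.of ρ - KZ.of r' ∈ KZ.relations := by
    refine stub_subgraphToBase d ρ r' (fun x => MvPolynomial.aeval x p)
      (by rw [hr'd]; exact isSemialgebraicFunOn_aeval (pc_isSemialgebraic_ratBox d a b) p)
      (fun x hx => hp x (by rw [hr'd] at hx; exact hx)) ?_ hone (fun x _ => by rw [hr'i])
    rw [hdom, hr'd]
    rfl
  obtain ⟨v, hv, h2⟩ := stub_polynomialBoxCell d a b p r' hab hr'd (fun x _ => by rw [hr'i])
  exact ⟨v, hv, by simpa only [sub_add_sub_cancel] using KZ.relations.add_mem h1 h2⟩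

/-! ## Products -/

/-- **PRODUCTS OF K-CELLS ARE K-CELLS (cylinders).** If the integrand-`1` representations `ρ`
(dimension `n`) and `σ` (dimension `m`) carry certificates `[ρ] ≡ [pt, v]`, `[σ] ≡ [pt, w]`, then
the integrand-`1` representation `τ` on the product domain `ρ.domain × σ.domain ⊆ ℝⁿ⁺ᵐ` carries
the certificate `[τ] ≡ [pt, v w]`: `τ` agrees with the Fubini product `ρ.prod σ` (rule (1b) with a
zero difference), `⟦ρ.prod σ⟧ = ⟦ρ⟧·⟦σ⟧` in the formal period ring (`KZ.toFormalPeriod_of_mul_of`,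
the relations being an ideal), and points multiply (`lindemann_pt_mul`). E.g. a polynomial
subgraph times an algebraic interval (a curved prism). [Kontsevich–Zagier 2001, §4.1] [folklore] -/
theorem prodPointCell {n m : ℕ} (ρ : KZ.IntegralRep n) (σ : KZ.IntegralRep m)
    (hρ1 : ∀ x ∈ ρ.domain, ρ.integrand x = 1) (hσ1 : ∀ y ∈ σ.domain, σ.integrand y = 1)
    {v w : ℝ} {hv : IsAlgebraic ℚ v} {hw : IsAlgebraic ℚ w}
    (hρ : KZ.of ρ - KZ.of (KZ.IntegralRep.unit.constMul v hv) ∈ KZ.relations)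
    (hσ : KZ.of σ - KZ.of (KZ.IntegralRep.unit.constMul w hw) ∈ KZ.relations)
    (τ : KZ.IntegralRep (n + m))
    (hdom : τ.domain = {z : Fin (n + m) → ℝ | (fun i => z (Fin.castAdd m i)) ∈ ρ.domain ∧
      (fun j => z (Fin.natAdd n j)) ∈ σ.domain})
    (hone : ∀ z ∈ τ.domain, τ.integrand z = 1) :
    KZ.of τ - KZ.of (KZ.IntegralRep.unit.constMul (v * w) (hv.mul hw)) ∈ KZ.relations := by
  -- `τ` agrees with the Fubini product `ρ.prod σ`
  have h1 : KZ.of τ - KZ.of (ρ.prod σ) ∈ KZ.relations := by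
    refine KZ.of_sub_of_mem_relations_of_eqOn (by rw [KZ.IntegralRep.prod_domain, hdom]; rfl)
      fun z hz => ?_
    have hz' : (fun i => z (Fin.castAdd m i)) ∈ ρ.domain ∧ (fun j => z (Fin.natAdd n j)) ∈ σ.domain := by
      rw [hdom] at hz
      exact hz
    rw [hone z hz, KZ.IntegralRep.prod_integrand_eq, KZ.IntegralRep.prodFun_apply, hρ1 _ hz'.1,
      hσ1 _ hz'.2, mul_one]
  -- in the formal period ring: `⟦ρ.prod σ⟧ = ⟦ρ⟧ ⟦σ⟧ = ⟦pt, v⟧ ⟦pt, w⟧ = ⟦pt, v w⟧`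
  have h2 : KZ.of (ρ.prod σ) - KZ.of (KZ.IntegralRep.unit.constMul (v * w) (hv.mul hw)) ∈
      KZ.relations := by
    rw [← KZ.toFormalPeriod_eq_iff, ← KZ.toFormalPeriod_of_mul_of, KZ.toFormalPeriod_eq_iff.2 hρ,
      KZ.toFormalPeriod_eq_iff.2 hσ,
      Summit.KontsevichZagierPeriods.HyperbolicBloch.OffTetraSectorKernel.lindemann_pt_mul hv hw]
  simpa only [sub_add_sub_cancel] using KZ.relations.add_mem h1 h2

/-! ## Headline instance: polytopes ⊕ balls -/

/-- **POLYTOPE ⊕ BALL PAIRS (every dimension `d ≥ 2`; an instance of the crux for `d ≥ 3` with the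
two period types `1` and `π^{⌊d/2⌋}` in one domain).** Two integrand-`1` representations of
dimension `d ≥ 2` whose domains are, almost everywhere, `ℤ`-combinations of indicators of open
simplices with REAL ALGEBRAIC vertices (affine images `A Δ_d + b`, `det A ≠ 0`) and of
real-algebraic open ELLIPSOIDS `A B_d + b`, and whose volumes agree, are KZ-equivalent
(`pointCellBallPairs` fed by `simplexPointCell`). E.g. any finite union of algebraic polytopes and
algebraic balls against any other of the same volume, once a signed triangulation of the
polytopes is written down. [Lindemann 1882; Kontsevich–Zagier 2001, §1.2] [folklore] -/
theorem polytopeBallPairs :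
    ∀ (d : ℕ), 2 ≤ d →
      ∀ (r r' : KZ.IntegralRep d) (k m k' m' : ℕ)
        (ρB : Fin k → KZ.IntegralRep d) (ρS : Fin m → KZ.IntegralRep d)
        (ρB' : Fin k' → KZ.IntegralRep d) (ρS' : Fin m' → KZ.IntegralRep d)
        (cB : Fin k → ℤ) (cS : Fin m → ℤ) (cB' : Fin k' → ℤ) (cS' : Fin m' → ℤ),
      (∀ x ∈ r.domain, r.integrand x = 1) → (∀ x ∈ r'.domain, r'.integrand x = 1) →
      (∀ i, ∀ x ∈ (ρB i).domain, (ρB i).integrand x = 1) →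
      (∀ ν, ∀ x ∈ (ρS ν).domain, (ρS ν).integrand x = 1) →
      (∀ i, ∀ x ∈ (ρB' i).domain, (ρB' i).integrand x = 1) →
      (∀ ν, ∀ x ∈ (ρS' ν).domain, (ρS' ν).integrand x = 1) →
      (∀ i, cB i ≠ 0 → ∃ (A : Matrix (Fin d) (Fin d) ℝ) (b : Fin d → ℝ),
        (∀ j l, IsAlgebraic ℚ (A j l)) ∧ (∀ j, IsAlgebraic ℚ (b j)) ∧ A.det ≠ 0 ∧
        (ρB i).domain = (fun x => A.mulVec x + b) ''
          {x : Fin d → ℝ | (∀ i, 0 < x i) ∧ ∑ i, x i < 1}) →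
      (∀ ν, cS ν ≠ 0 → ∃ (A : Matrix (Fin d) (Fin d) ℝ) (b : Fin d → ℝ),
        (∀ j l, IsAlgebraic ℚ (A j l)) ∧ (∀ j, IsAlgebraic ℚ (b j)) ∧ A.det ≠ 0 ∧
        (ρS ν).domain = (fun x => A.mulVec x + b) '' {z : Fin d → ℝ | ∑ i, (z i) ^ 2 < 1}) →
      (∀ i, cB' i ≠ 0 → ∃ (A : Matrix (Fin d) (Fin d) ℝ) (b : Fin d → ℝ),
        (∀ j l, IsAlgebraic ℚ (A j l)) ∧ (∀ j, IsAlgebraic ℚ (b j)) ∧ A.det ≠ 0 ∧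
        (ρB' i).domain = (fun x => A.mulVec x + b) ''
          {x : Fin d → ℝ | (∀ i, 0 < x i) ∧ ∑ i, x i < 1}) →
      (∀ ν, cS' ν ≠ 0 → ∃ (A : Matrix (Fin d) (Fin d) ℝ) (b : Fin d → ℝ),
        (∀ j l, IsAlgebraic ℚ (A j l)) ∧ (∀ j, IsAlgebraic ℚ (b j)) ∧ A.det ≠ 0 ∧
        (ρS' ν).domain = (fun x => A.mulVec x + b) '' {z : Fin d → ℝ | ∑ i, (z i) ^ 2 < 1}) →
      (∀ᵐ x : Fin d → ℝ, r.domain.indicator (fun _ => (1 : ℝ)) x =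
        ∑ i, (cB i : ℝ) * (ρB i).domain.indicator (fun _ => (1 : ℝ)) x +
          ∑ ν, (cS ν : ℝ) * (ρS ν).domain.indicator (fun _ => (1 : ℝ)) x) →
      (∀ᵐ x : Fin d → ℝ, r'.domain.indicator (fun _ => (1 : ℝ)) x =
        ∑ i, (cB' i : ℝ) * (ρB' i).domain.indicator (fun _ => (1 : ℝ)) x +
          ∑ ν, (cS' ν : ℝ) * (ρS' ν).domain.indicator (fun _ => (1 : ℝ)) x) →
      r.value = r'.value → KZ.Equivalent r r' := by
  intro d hd r r' k m k' m' ρB ρS ρB' ρS' cB cS cB' cS' hr hr' hρB hρS hρB' hρS' hcB hcS hcB' hcS'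
    hdec hdec' hval
  refine pointCellBallPairs d hd r r' k m k' m' ρB ρS ρB' ρS' cB cS cB' cS' hr hr' hρB hρS hρB'
    hρS' (fun i hi => ?_) hcS (fun i hi => ?_) hcS' hdec hdec' hval
  · obtain ⟨A, b, hA, hb, hdet, hdomi⟩ := hcB i hi
    exact simplexPointCell d A b hA hb hdet (ρB i) hdomi (hρB i)
  · obtain ⟨A, b, hA, hb, hdet, hdomi⟩ := hcB' i hi
    exact simplexPointCell d A b hA hb hdet (ρB' i) hdomi (hρB' i)

end Summit.KontsevichZagierPeriods.SymplecticScissors.LogPolytope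

end
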